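/-
Copyright: pub-rosobs cell (Resolution Observatory), carver gen 40.  Companion file; statements OURS, in
the cell's polynomial weighted-centre model `W(f)`.  Instrument — NOT a resolution theorem.
-/
import Literature.AlgebraicGeometry.Resolution.WeightedCentreUmbrellaPowMax
import Mathlib.Algebra.Polynomial.Degree.TrailingDegree
import HarnessLib

/-!
# The second vertex of `W(v² + u w² + z^q)`: `(2, 3, 3, c, …) ∉ W` for `c > q`; hence `max W = (2, 3, 3, q)`

Cell model (see `WeightedCentreInvariantSet`): `W(f) = admissibleInvariants f` is the set of invariants
`(1/γ₁ ≤ 1/γ₂ ≤ …)` of centres `(Ψ, γ)` — `Ψ` ANY `k`-algebra automorphism of `k[X_1, …, X_N]` fixing the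
origin, `γ` non-negative rational weights — that are admissible for `f` (every monomial of `Ψ⁻¹ f` has
`γ`-value `≥ 1`).  For the census germ `f = X_i² + X_l X_j² + X_e^q` (`i, j, l, e` distinct, any number of
spectator variables) the first face (`WeightedCentreUmbrellaPowBound`), the second face
(`WeightedCentreSecondFaceSpectators`) and `[] ∉ W` (`WeightedCentreUmbrellaPowMax`) left exactly one
inequality open: a maximal element is `(2, 3, 3, c, …)` with `c ≥ q`, and `c ≤ q` was missing.

**Main results.**
* `not_isCentreFor_umbrellaPow_vertex`: for `3 ≤ q < c` and (`2 ≠ 0` in `k` or `q` odd) there is no centre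
  with one weight `1/2`, two weights `1/3` and all other weights `≤ 1/c`;
* `cons₄_not_mem_admissibleInvariants_umbrellaPow`: `(2, 3, 3, c, …) ∉ W(f)` for every `c > q`;
* `isMaxInv_umbrellaPow`, `isMaxInv_umbrellaAddPow`: **`max W(f) = (2, 3, 3, q)`** for `q ≥ 4` with
  `q ≠ 0` in `k` — the census value of `v² + u w² + z^q` is certified in the model, with spectators and
  against all polynomial coordinate changes.

**Proof.**  (1) *Apex* (`coeff_single_apex`): the directrix of `in₂ f = X_i²` forces the linear part of
`v' = Ψ(X_a)` (`γ a = 1/2`) to be `λ X_i`, `λ ≠ 0`.  (2) *Axis lemma* (`coeff_single_symm_eq_zero_of_vertex`):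
fix an axis `X_{e₁}` of weight `≤ 1/c` and restrict along it by `ρ = (X_{e₁} ↦ T, others ↦ 0) ∘ Ψ⁻¹`.  For
a vector field `ξ` the *Taylor map* `fieldTaylor ρ ξ : P ↦ Σ_m (C ρX_m + ε C ρξ_m)`-substitution lands in
`k[T][ε]`; its `ε⁰, ε¹`-coefficients are `ρ P` and `ρ (Σ ξ_m ∂_m P)`.  For `ξ = ∂_v` and the two fields
`ξ_x = (∂_v v') ∂_x − (∂_x v') ∂_v` (`x = u, w`), which kill `v'` to first order, the images of the centre
variables have weighted order `≥` their weights for the bigrading `(wt ε, wt T) = (c/2 or c/3, 1)`; hence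
(`VanBelow₂.map_of_le_monomialValuation`) `fieldTaylor(f) = fieldTaylor(Ψ (Ψ⁻¹ f))` has weighted order
`≥ c`.  Reading off the `ε⁰, ε¹, ε²`-coefficients of the three explicit expansions gives six `T`-adic
vanishing statements for `V, W, U, Z = ρ X_{i,j,l,e}`, `L = ρ ∂_i v'` (`L(0) = λ ≠ 0`), `A = ρ ∂_l v'`,
`B = ρ ∂_j v'`.  (3) *Endgame* (`axis_endgame`, pure `k[T]`): `W` has order `≥ c/3`, so `W₁ = 0`; `V₁ = 0`
from the `T²`-coefficient of `V² + U W² + Z^q`; `U₁ = 0` from `B² + L² U`; and `Z₁ ≠ 0` is impossible: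
`L²V² − B²W² + L²Z^q` vanishes below `c > q` while `L² Z^q` has leading term `L(0)² Z₁^q T^q` — in
characteristic `2` with `q` odd a square has no `T^q`-term, and otherwise `V` has order `≥ c/2`, so
`ord(BW) = q/2` and `B (BW + LV)` vanishing below `2c/3` forces `ord V ≤ q/2 < c/2`.  (4) *Rank*
(`not_isCentreFor_umbrellaPow_vertex`): the rows `v, w, u, z` of the Jacobian of `Ψ⁻¹` at `0` are
supported on the three columns `a, b₁, b₂`, contradicting `P Q = 1` on a `4 × 4` block.

**Sharpness.**  In characteristic `2` with `q` even, `f = (X_i + X_e^{q/2})² + X_l X_j²` and the centre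
`(X_i + X_e^{q/2}, X_j, X_l, X_e^{1/c})` is admissible for every `c`, so `2 ≠ 0 ∨ q odd` cannot be dropped
from the vertex theorem (`isMaxInv_umbrellaPow` assumes `q ≠ 0` in `k`, which implies it).

References: [AbramovichTemkinWlodarczyk2024, Thm. 5.3.1 (2) (p. 1578) (the invariant is the maximum over
admissible centres), Lemma 5.2.10 (p. 1577), §5.1 (p. 1575)]; [Temkin2025, §1.2.2 (1) (p. 4) (the example
`v² + u w² + z^q`)]; [CossartJannsenSaito2020, Def. 1.26, Def. 7.1 (directrix)].  Statements ours (the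
cell's model `W(f)`); value type: typed theorems in the polynomial weighted-centre model — NOT a resolution
theorem, NOT summit progress.
-/

open MvPolynomial

namespace Literature.AlgebraicGeometry.Resolution.WeightedBlowup

variable {k : Type*} [Field k] {N : ℕ}

/-! ## §1 `T`-adic vanishing below a rational order (one variable) -/

section VanBelow

/-- `VanBelow r P`: every coefficient of `P ∈ k[T]` of degree `< r` (`r ∈ ℚ`) vanishes, i.e.
`P ∈ (T^⌈r⌉)`. (construction, plumbing) [cite: CossartJannsenSaito2020, Def. 1.26 (order along a regular
subscheme)] -/
def VanBelow (r : ℚ) (P : Polynomial k) : Prop := ∀ n : ℕ, (n : ℚ) < r → P.coeff n = 0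

variable {r s : ℚ} {P Q : Polynomial k}

/-- Nothing is required below a non-positive order (plumbing).
[cite: CossartJannsenSaito2020, Def. 1.26 (order along `T = 0`)] -/
theorem VanBelow.of_nonpos (hr : r ≤ 0) (P : Polynomial k) : VanBelow r P :=
  fun n hn => absurd (hn.trans_le hr) (not_lt.2 (Nat.cast_nonneg n))

/-- `0` vanishes below every order (plumbing). [cite: CossartJannsenSaito2020, Def. 1.26 (order along `T = 0`)] -/
theorem VanBelow.zero (r : ℚ) : VanBelow r (0 : Polynomial k) := fun _ _ => Polynomial.coeff_zero _

/-- Monotonicity in the order (plumbing). [cite: CossartJannsenSaito2020, Def. 1.26 (order along `T = 0`)] -/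
theorem VanBelow.mono (h : VanBelow r P) (hs : s ≤ r) : VanBelow s P := fun n hn => h n (hn.trans_le hs)

/-- Sums (plumbing). [cite: CossartJannsenSaito2020, Def. 1.26 (order along `T = 0`)] -/
theorem VanBelow.add (hP : VanBelow r P) (hQ : VanBelow r Q) : VanBelow r (P + Q) := fun n hn => by
  rw [Polynomial.coeff_add, hP n hn, hQ n hn, add_zero]

/-- Differences (plumbing). [cite: CossartJannsenSaito2020, Def. 1.26 (order along `T = 0`)] -/
theorem VanBelow.sub (hP : VanBelow r P) (hQ : VanBelow r Q) : VanBelow r (P - Q) := fun n hn => by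
  rw [Polynomial.coeff_sub, hP n hn, hQ n hn, sub_zero]

/-- **Products add orders** (plumbing). [cite: CossartJannsenSaito2020, Def. 1.26 (order along `T = 0`)] -/
theorem VanBelow.mul (hP : VanBelow r P) (hQ : VanBelow s Q) : VanBelow (r + s) (P * Q) := by
  intro n hn
  rw [Polynomial.coeff_mul]
  refine Finset.sum_eq_zero fun x hx => ?_
  rw [Finset.mem_antidiagonal] at hx
  by_cases h1 : (x.1 : ℚ) < r
  · rw [hP _ h1, zero_mul]
  · have e : (x.1 : ℚ) + x.2 = n := by exact_mod_cast hx
    have h2 : (x.2 : ℚ) < s := by push Not at h1; linarith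
    rw [hQ _ h2, mul_zero]

/-- Left multiples (plumbing). [cite: CossartJannsenSaito2020, Def. 1.26 (order along `T = 0`)] -/
theorem VanBelow.mul_left (hQ : VanBelow r Q) (P : Polynomial k) : VanBelow r (P * Q) := by
  have := (VanBelow.of_nonpos le_rfl P).mul hQ
  rwa [zero_add] at this

/-- Right multiples (plumbing). [cite: CossartJannsenSaito2020, Def. 1.26 (order along `T = 0`)] -/
theorem VanBelow.mul_right (hP : VanBelow r P) (Q : Polynomial k) : VanBelow r (P * Q) := by
  have := hP.mul (VanBelow.of_nonpos le_rfl Q)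
  rwa [add_zero] at this

/-- Powers (plumbing). [cite: CossartJannsenSaito2020, Def. 1.26 (order along `T = 0`)] -/
theorem VanBelow.pow (hP : VanBelow r P) (m : ℕ) : VanBelow (m * r) (P ^ m) := by
  induction m with
  | zero => rw [Nat.cast_zero, zero_mul, pow_zero]; exact VanBelow.of_nonpos le_rfl _
  | succ m ih => rw [pow_succ, Nat.cast_succ, add_mul, one_mul]; exact ih.mul hP

/-- A polynomial vanishing at `0` vanishes below order `1` (plumbing).
[cite: CossartJannsenSaito2020, Def. 1.26 (order along `T = 0`)] -/
theorem vanBelow_one_of_coeff_zero (h : P.coeff 0 = 0) : VanBelow 1 P := by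
  intro n hn
  have hn1 : n < 1 := by exact_mod_cast hn
  rw [Nat.lt_one_iff.1 hn1, h]

/-- For `P ≠ 0`: `P` vanishes below `r` iff `r ≤ ord_T P` (plumbing).
[cite: CossartJannsenSaito2020, Def. 1.26 (order along `T = 0`)] -/
theorem vanBelow_iff_le_natTrailingDegree (hP : P ≠ 0) : VanBelow r P ↔ r ≤ P.natTrailingDegree := by
  constructor
  · intro h
    by_contra hlt
    push Not at hlt
    exact Polynomial.trailingCoeff_nonzero_iff_nonzero.2 hP (h _ hlt)
  · intro h n hn
    exact Polynomial.coeff_eq_zero_of_lt_natTrailingDegree (by exact_mod_cast hn.trans_le h)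

/-- **Cancelling a unit factor**: if `L(0) ≠ 0` and `L·P` vanishes below `r`, so does `P` (plumbing).
[cite: CossartJannsenSaito2020, Def. 1.26 (order along `T = 0`)] -/
theorem VanBelow.of_mul_left {L : Polynomial k} (hL : L.coeff 0 ≠ 0) (h : VanBelow r (L * P)) :
    VanBelow r P := by
  by_cases hP : P = 0
  · rw [hP]; exact VanBelow.zero r
  have hL0 : L ≠ 0 := fun h0 => hL (by rw [h0, Polynomial.coeff_zero])
  have hntd : L.natTrailingDegree = 0 := Nat.le_zero.1 (Polynomial.natTrailingDegree_le_of_ne_zero hL)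
  rw [vanBelow_iff_le_natTrailingDegree (mul_ne_zero hL0 hP), Polynomial.natTrailingDegree_mul hL0 hP, hntd,
    zero_add] at h
  exact (vanBelow_iff_le_natTrailingDegree hP).2 h

/-- **Square roots halve orders**: if `P²` vanishes below `r` then `P` vanishes below `r/2` (plumbing).
[cite: CossartJannsenSaito2020, Def. 1.26 (order along `T = 0`)] -/
theorem VanBelow.of_sq (h : VanBelow r (P ^ 2)) : VanBelow (r / 2) P := by
  by_cases hP : P = 0
  · rw [hP]; exact VanBelow.zero _
  rw [vanBelow_iff_le_natTrailingDegree (pow_ne_zero 2 hP), pow_two, Polynomial.natTrailingDegree_mul hP hP] at h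
  rw [vanBelow_iff_le_natTrailingDegree hP]
  push_cast at h
  linarith

/-- The constant coefficient of a power (plumbing). [folklore] -/
private theorem coeff_zero_pow' (P : Polynomial k) (m : ℕ) : (P ^ m).coeff 0 = P.coeff 0 ^ m := by
  simp [Polynomial.coeff_zero_eq_eval_zero]

/-- In characteristic `2` a square has no odd coefficients (plumbing). [folklore] -/
private theorem coeff_sq_odd_eq_zero (h2 : (2 : k) = 0) (S : Polynomial k) (m : ℕ) : (S ^ 2).coeff (2 * m + 1) = 0 := by
  have h2' : (2 : Polynomial k) = 0 := by rw [← map_ofNat Polynomial.C 2, h2, map_zero]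
  induction S using Polynomial.induction_on' generalizing m with
  | add p q hp hq =>
    have e : (p + q) ^ 2 = p ^ 2 + q ^ 2 := by linear_combination (p * q) * h2'
    rw [e, Polynomial.coeff_add, hp, hq, add_zero]
  | monomial n a =>
    rw [Polynomial.monomial_pow, Polynomial.coeff_monomial, if_neg]
    omega

end VanBelow

/-! ## §2 Weighted vanishing in two variables `k[T][ε]` -/

section VanBelow₂

/-- `VanBelow₂ α β s P`: the `ε^j T^n`-coefficient of `P ∈ k[T][ε]` vanishes whenever `j α + n β < s`
(weighted order `≥ s` for the weights `(α, β)` on `(ε, T)`). (construction, plumbing)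
[cite: CossartJannsenSaito2020, Def. 1.26 (initial forms along a regular subscheme);
AbramovichTemkinWlodarczyk2024, §5.1 (weighted orders)] -/
def VanBelow₂ (α β s : ℚ) (P : Polynomial (Polynomial k)) : Prop :=
  ∀ j n : ℕ, (j : ℚ) * α + (n : ℚ) * β < s → (P.coeff j).coeff n = 0

variable {α β s t : ℚ} {P Q : Polynomial (Polynomial k)}

/-- Nothing is required below a non-positive weighted order (plumbing).
[cite: AbramovichTemkinWlodarczyk2024, §5.1 (p. 1575) (`γ`-weighted order)] -/
theorem VanBelow₂.of_nonpos (hα : 0 ≤ α) (hβ : 0 ≤ β) (hs : s ≤ 0) (P : Polynomial (Polynomial k)) :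
    VanBelow₂ α β s P :=
  fun j n hjn => absurd (hjn.trans_le hs) (not_lt.2 (by positivity))

/-- Monotonicity (plumbing). [cite: AbramovichTemkinWlodarczyk2024, §5.1 (p. 1575) (`γ`-weighted order)] -/
theorem VanBelow₂.mono (h : VanBelow₂ α β s P) (hts : t ≤ s) : VanBelow₂ α β t P :=
  fun j n hjn => h j n (hjn.trans_le hts)

/-- Sums (plumbing). [cite: AbramovichTemkinWlodarczyk2024, §5.1 (p. 1575) (`γ`-weighted order)] -/
theorem VanBelow₂.add (hP : VanBelow₂ α β s P) (hQ : VanBelow₂ α β s Q) : VanBelow₂ α β s (P + Q) :=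
  fun j n hjn => by rw [Polynomial.coeff_add, Polynomial.coeff_add, hP j n hjn, hQ j n hjn, add_zero]

/-- Finite sums (plumbing). [cite: AbramovichTemkinWlodarczyk2024, §5.1 (p. 1575) (`γ`-weighted order)] -/
theorem VanBelow₂.sum {ι : Type*} (S : Finset ι) {F : ι → Polynomial (Polynomial k)}
    (h : ∀ x ∈ S, VanBelow₂ α β s (F x)) : VanBelow₂ α β s (∑ x ∈ S, F x) := fun j n hjn => by
  rw [Polynomial.finsetSum_coeff, Polynomial.finsetSum_coeff]
  exact Finset.sum_eq_zero fun x hx => h x hx j n hjn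

/-- **Products add weighted orders** (plumbing).
[cite: AbramovichTemkinWlodarczyk2024, §5.1 (p. 1575) (`γ`-weighted order)] -/
theorem VanBelow₂.mul (hP : VanBelow₂ α β s P) (hQ : VanBelow₂ α β t Q) : VanBelow₂ α β (s + t) (P * Q) := by
  intro j n hjn
  rw [Polynomial.coeff_mul, Polynomial.finsetSum_coeff]
  refine Finset.sum_eq_zero fun x hx => ?_
  rw [Polynomial.coeff_mul]
  refine Finset.sum_eq_zero fun y hy => ?_
  rw [Finset.mem_antidiagonal] at hx hy
  by_cases h1 : (x.1 : ℚ) * α + (y.1 : ℚ) * β < s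
  · rw [hP _ _ h1, zero_mul]
  · have ex : (x.1 : ℚ) + x.2 = j := by exact_mod_cast hx
    have ey : (y.1 : ℚ) + y.2 = n := by exact_mod_cast hy
    have e : (j : ℚ) * α + (n : ℚ) * β = ((x.1 : ℚ) * α + (y.1 : ℚ) * β) + ((x.2 : ℚ) * α + (y.2 : ℚ) * β) := by
      rw [← ex, ← ey]; ring
    have h2 : (x.2 : ℚ) * α + (y.2 : ℚ) * β < t := by push Not at h1; linarith
    rw [hQ _ _ h2, mul_zero]

/-- Finite products (plumbing). [cite: AbramovichTemkinWlodarczyk2024, §5.1 (p. 1575) (`γ`-weighted order)] -/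
theorem VanBelow₂.prod (hα : 0 ≤ α) (hβ : 0 ≤ β) {ι : Type*} (S : Finset ι)
    {F : ι → Polynomial (Polynomial k)} {w : ι → ℚ} (h : ∀ x ∈ S, VanBelow₂ α β (w x) (F x)) :
    VanBelow₂ α β (∑ x ∈ S, w x) (∏ x ∈ S, F x) := by
  classical
  induction S using Finset.induction_on with
  | empty => rw [Finset.sum_empty, Finset.prod_empty]; exact VanBelow₂.of_nonpos hα hβ le_rfl _
  | insert x S hx ih =>
    rw [Finset.sum_insert hx, Finset.prod_insert hx]
    exact (h x (Finset.mem_insert_self x S)).mul (ih fun y hy => h y (Finset.mem_insert_of_mem hy))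

/-- Powers (plumbing). [cite: AbramovichTemkinWlodarczyk2024, §5.1 (p. 1575) (`γ`-weighted order)] -/
theorem VanBelow₂.pow (hα : 0 ≤ α) (hβ : 0 ≤ β) (hP : VanBelow₂ α β s P) (m : ℕ) :
    VanBelow₂ α β (m * s) (P ^ m) := by
  induction m with
  | zero => rw [Nat.cast_zero, zero_mul, pow_zero]; exact VanBelow₂.of_nonpos hα hβ le_rfl _
  | succ m ih => rw [pow_succ, Nat.cast_succ, add_mul, one_mul]; exact ih.mul hP

/-- `ε^m ∣ P` gives weighted order `≥ m α` (plumbing).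
[cite: AbramovichTemkinWlodarczyk2024, §5.1 (p. 1575) (`γ`-weighted order)] -/
theorem VanBelow₂.of_X_pow_dvd (hα : 0 ≤ α) (hβ : 0 ≤ β) {m : ℕ} (h : Polynomial.X ^ m ∣ P) :
    VanBelow₂ α β (m * α) P := by
  obtain ⟨R, rfl⟩ := h
  intro j n hjn
  rw [Polynomial.coeff_X_pow_mul']
  split_ifs with hmj
  · exfalso
    have : (m : ℚ) * α ≤ j * α := mul_le_mul_of_nonneg_right (by exact_mod_cast hmj) hα
    have : (0 : ℚ) ≤ n * β := by positivity
    linarith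
  · rfl

/-- A polynomial whose `ε⁰T⁰`-coefficient vanishes has weighted order `≥ min(α, β)` (plumbing).
[cite: AbramovichTemkinWlodarczyk2024, §5.1 (p. 1575) (`γ`-weighted order)] -/
theorem VanBelow₂.of_coeff_coeff_zero (hα : 0 ≤ α) (hβ : 0 ≤ β) (hsα : s ≤ α) (hsβ : s ≤ β)
    (h0 : (P.coeff 0).coeff 0 = 0) : VanBelow₂ α β s P := by
  intro j n hjn
  rcases Nat.eq_zero_or_pos j with rfl | hj
  · rcases Nat.eq_zero_or_pos n with rfl | hn
    · exact h0
    · exfalso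
      have h1 : (1 : ℚ) ≤ n := by exact_mod_cast hn
      have : β ≤ (n : ℚ) * β := by nlinarith
      push_cast at hjn
      linarith
  · exfalso
    have h1 : (1 : ℚ) ≤ j := by exact_mod_cast hj
    have : α ≤ (j : ℚ) * α := by nlinarith
    have : (0 : ℚ) ≤ n * β := by positivity
    linarith

/-- The sum formula for the monomial valuation (plumbing). [folklore] -/
private theorem monomialValuation_eq_sum_univ' (γ : Fin N → ℚ) (d : Fin N →₀ ℕ) :
    monomialValuation γ d = ∑ i, (d i : ℚ) * γ i := by
  rw [monomialValuation, Finsupp.sum_fintype]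
  intro i; simp

/-- **Transfer of admissibility.**  If an algebra map `φ : k[X] → k[T][ε]` sends every `X_m` to an
element of weighted order `≥ γ_m`, then it sends a polynomial all of whose monomials have `γ`-value `≥ s`
to an element of weighted order `≥ s`. (derived here) [cite: AbramovichTemkinWlodarczyk2024, §5.1
(p. 1575) (admissibility `f ∈ J^γ` read on monomials); CossartJannsenSaito2020, Def. 1.26] -/
theorem VanBelow₂.map_of_le_monomialValuation (hα : 0 ≤ α) (hβ : 0 ≤ β)
    (φ : MvPolynomial (Fin N) k →ₐ[k] Polynomial (Polynomial k)) {γ : Fin N → ℚ}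
    (hφ : ∀ m, VanBelow₂ α β (γ m) (φ (X m))) {g : MvPolynomial (Fin N) k}
    (hg : ∀ d ∈ g.support, s ≤ monomialValuation γ d) : VanBelow₂ α β s (φ g) := by
  classical
  rw [g.as_sum, map_sum]
  refine VanBelow₂.sum _ fun d hd => ?_
  rw [monomial_eq, Finsupp.prod_fintype _ _ (fun i => pow_zero _), map_mul, algHom_C, map_prod]
  have h1 : VanBelow₂ α β 0 (algebraMap k (Polynomial (Polynomial k)) (coeff d g)) :=
    VanBelow₂.of_nonpos hα hβ le_rfl _
  have h2 : VanBelow₂ α β (∑ i, (d i : ℚ) * γ i) (∏ i, φ (X i ^ d i)) :=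
    VanBelow₂.prod hα hβ _ fun i _ => by rw [map_pow]; exact (hφ i).pow hα hβ _
  have := h1.mul h2
  rw [zero_add, ← monomialValuation_eq_sum_univ'] at this
  exact this.mono (hg d hd)

end VanBelow₂

/-! ## §3 Taylor expansion along a vector field -/

section FieldTaylor

/-- **Taylor map along a vector field at an axis point**: `X_m ↦ ρ(X_m) + ε·ρ(ξ_m)`, for an axis
restriction `ρ : k[X] → k[T]` and a polynomial vector field `ξ`. (construction, plumbing)
[cite: CossartJannsenSaito2020, Def. 1.26 (restriction to / expansion along a regular subscheme)] -/
noncomputable def fieldTaylor (ρ : MvPolynomial (Fin N) k →ₐ[k] Polynomial k)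
    (ξ : Fin N → MvPolynomial (Fin N) k) : MvPolynomial (Fin N) k →ₐ[k] Polynomial (Polynomial k) :=
  aeval fun m => Polynomial.C (ρ (X m)) + Polynomial.X * Polynomial.C (ρ (ξ m))

variable (ρ : MvPolynomial (Fin N) k →ₐ[k] Polynomial k) (ξ : Fin N → MvPolynomial (Fin N) k)

/-- The Taylor map on a variable (plumbing). [cite: CossartJannsenSaito2020, Def. 1.26] -/
theorem fieldTaylor_X (m : Fin N) :
    fieldTaylor ρ ξ (X m) = Polynomial.C (ρ (X m)) + Polynomial.X * Polynomial.C (ρ (ξ m)) := by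
  rw [fieldTaylor, aeval_X]

/-- **Order `0`**: the `ε⁰`-coefficient of the Taylor map is the restriction `ρ`. (derived here)
[cite: CossartJannsenSaito2020, Def. 1.26] -/
theorem coeff_zero_fieldTaylor (P : MvPolynomial (Fin N) k) : (fieldTaylor ρ ξ P).coeff 0 = ρ P := by
  induction P using MvPolynomial.induction_on with
  | C a => rw [fieldTaylor, algHom_C, Polynomial.algebraMap_apply, Polynomial.coeff_C_zero, algHom_C]
  | add p q hp hq => rw [map_add, Polynomial.coeff_add, hp, hq, map_add]
  | mul_X p m hp =>
    rw [map_mul, fieldTaylor_X, Polynomial.mul_coeff_zero, hp, Polynomial.coeff_add, Polynomial.coeff_C_zero,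
      Polynomial.mul_coeff_zero, Polynomial.coeff_X_zero, zero_mul, add_zero, map_mul]

/-- **Order `1`**: the `ε¹`-coefficient of the Taylor map along `ξ` is the restriction of the derivative
`ξ(P) = Σ_m ξ_m ∂_m P`. (derived here) [cite: CossartJannsenSaito2020, Def. 1.26;
AbramovichTemkinWlodarczyk2024, Lemma 5.2.10 (p. 1577) (derivatives and maximal contact)] -/
theorem coeff_one_fieldTaylor (P : MvPolynomial (Fin N) k) :
    (fieldTaylor ρ ξ P).coeff 1 = ρ (∑ m, ξ m * pderiv m P) := by
  classical
  induction P using MvPolynomial.induction_on with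
  | C a =>
    rw [fieldTaylor, algHom_C, Polynomial.algebraMap_apply, Polynomial.coeff_C, if_neg one_ne_zero]
    simp only [pderiv_C, mul_zero, Finset.sum_const_zero, map_zero]
  | add p q hp hq =>
    rw [map_add, Polynomial.coeff_add, hp, hq, ← map_add, ← Finset.sum_add_distrib]
    congr 1
    exact Finset.sum_congr rfl fun m _ => by rw [map_add, mul_add]
  | mul_X p m hp =>
    have h0 := coeff_zero_fieldTaylor ρ ξ p
    have e1 : (fieldTaylor ρ ξ p * Polynomial.X).coeff 1 = (fieldTaylor ρ ξ p).coeff 0 := by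
      simp
    rw [map_mul, fieldTaylor_X, mul_add, Polynomial.coeff_add, Polynomial.coeff_mul_C, hp, ← mul_assoc,
      Polynomial.coeff_mul_C, e1, h0]
    have hsum : ∑ m', ξ m' * pderiv m' (p * X m) = X m * (∑ m', ξ m' * pderiv m' p) + ξ m * p := by
      simp only [Derivation.leibniz, pderiv_X, smul_eq_mul, mul_add, Finset.sum_add_distrib]
      rw [add_comm]
      congr 1
      · rw [Finset.mul_sum]
        exact Finset.sum_congr rfl fun m' _ => by ring
      · rw [Finset.sum_eq_single m]
        · rw [Pi.single_eq_same, mul_one]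
        · intro m' _ hm'
          rw [Pi.single_eq_of_ne' hm', mul_zero, mul_zero]
        · intro h; exact absurd (Finset.mem_univ m) h
    rw [hsum, map_add, map_mul, map_mul]
    ring

variable {ρ ξ}

/-- `ε ∣ Taylor(P)` when `P` vanishes at the axis point (plumbing). [cite: CossartJannsenSaito2020, Def. 1.26] -/
theorem X_dvd_fieldTaylor {P : MvPolynomial (Fin N) k} (h0 : ρ P = 0) :
    Polynomial.X ∣ fieldTaylor ρ ξ P := by
  rw [Polynomial.X_dvd_iff, coeff_zero_fieldTaylor, h0]

/-- **`ε² ∣ Taylor(P)` along a vector field tangent to `{P = 0}`**: if `ρ(P) = 0` and `ρ(ξ P) = 0`.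
(derived here) [cite: AbramovichTemkinWlodarczyk2024, Lemma 5.2.10 (p. 1577); CossartJannsenSaito2020,
Def. 1.26] -/
theorem X_sq_dvd_fieldTaylor {P : MvPolynomial (Fin N) k} (h0 : ρ P = 0)
    (h1 : ρ (∑ m, ξ m * pderiv m P) = 0) : Polynomial.X ^ 2 ∣ fieldTaylor ρ ξ P := by
  rw [Polynomial.X_pow_dvd_iff]
  intro d hd
  interval_cases d
  · rw [coeff_zero_fieldTaylor, h0]
  · rw [coeff_one_fieldTaylor, h1]

/-- Coefficients of the normal form `C p₀ + C p₁ · ε + C p₂ · ε²` (plumbing). [folklore] -/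
private theorem coeff_normalForm (p₀ p₁ p₂ : Polynomial k) :
    (Polynomial.C p₀ + Polynomial.C p₁ * Polynomial.X + Polynomial.C p₂ * Polynomial.X ^ 2).coeff 0 = p₀ ∧
    (Polynomial.C p₀ + Polynomial.C p₁ * Polynomial.X + Polynomial.C p₂ * Polynomial.X ^ 2).coeff 1 = p₁ ∧
    (Polynomial.C p₀ + Polynomial.C p₁ * Polynomial.X + Polynomial.C p₂ * Polynomial.X ^ 2).coeff 2 = p₂ := by
  simp only [Polynomial.coeff_add, Polynomial.coeff_C, Polynomial.coeff_C_mul_X, Polynomial.coeff_C_mul_X_pow]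
  simp

/-- The two-point vector field `p ∂_i + q ∂_x` (construction, plumbing). [folklore] -/
noncomputable def pairField (i x : Fin N) (p q : MvPolynomial (Fin N) k) : Fin N → MvPolynomial (Fin N) k :=
  fun m => if m = i then p else if m = x then q else 0

/-- `(p ∂_i + q ∂_x)(P) = p ∂_i P + q ∂_x P` (plumbing). [folklore] -/
private theorem sum_pairField_mul {i x : Fin N} (hix : i ≠ x) (p q : MvPolynomial (Fin N) k)
    (D : Fin N → MvPolynomial (Fin N) k) :
    ∑ m, pairField i x p q m * D m = p * D i + q * D x := by
  classical
  have : ∀ m, pairField i x p q m * D m = (if m = i then p * D i else 0) + (if m = x then q * D x else 0) := by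
    intro m
    unfold pairField
    by_cases h1 : m = i
    · subst h1; rw [if_pos rfl, if_pos rfl, if_neg hix, add_zero]
    · rw [if_neg h1, if_neg h1, zero_add]
      by_cases h2 : m = x
      · subst h2; rw [if_pos rfl, if_pos rfl]
      · rw [if_neg h2, if_neg h2, zero_mul]
  rw [Finset.sum_congr rfl fun m _ => this m, Finset.sum_add_distrib, Finset.sum_ite_eq' Finset.univ i,
    Finset.sum_ite_eq' Finset.univ x, if_pos (Finset.mem_univ _), if_pos (Finset.mem_univ _)]

/-- The constant coefficient of a partial derivative is the linear coefficient (plumbing). [folklore] -/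
private theorem constantCoeff_pderiv (y : Fin N) (P : MvPolynomial (Fin N) k) :
    constantCoeff (pderiv y P) = coeff (Finsupp.single y 1) P := by
  classical
  induction P using MvPolynomial.induction_on with
  | C a =>
    rw [pderiv_C, map_zero, coeff_C, if_neg (Finsupp.single_ne_zero.2 one_ne_zero).symm]
  | add p q hp hq => rw [map_add, map_add, hp, hq, coeff_add]
  | mul_X p m hp =>
    rw [Derivation.leibniz, smul_eq_mul, smul_eq_mul, map_add, map_mul, map_mul, constantCoeff_X, zero_mul,
      add_zero, pderiv_X, coeff_mul_X']
    by_cases hmy : m = y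
    · subst hmy
      rw [Pi.single_eq_same, map_one, mul_one, if_pos (by simp), tsub_self, ← constantCoeff_eq]
    · have hns : m ∉ (Finsupp.single y 1).support := fun h =>
        hmy ((Finsupp.mem_support_single _ _ _).1 h).1
      rw [Pi.single_eq_of_ne hmy, map_zero, mul_zero, if_neg hns]

/-- An automorphism fixing the origin preserves constant coefficients (plumbing). [folklore] -/
private theorem constantCoeff_map_of_fix (Φ : MvPolynomial (Fin N) k ≃ₐ[k] MvPolynomial (Fin N) k)
    (hΦ : ∀ m, constantCoeff (Φ (X m)) = 0) (P : MvPolynomial (Fin N) k) :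
    constantCoeff (Φ P) = constantCoeff P := by
  induction P using MvPolynomial.induction_on with
  | C a => rw [show Φ (C a) = C a from Φ.commutes a]
  | add p q hp hq => rw [map_add, map_add, hp, hq, map_add]
  | mul_X p m hp => rw [map_mul, map_mul, hp, hΦ, map_mul, constantCoeff_X]

end FieldTaylor

/-! ## §4 The endgame on an axis (pure `k[T]` algebra) -/

section Endgame

/-- **Axis endgame.**  Let `V, W, U, Z ∈ k[T]` vanish at `0`, `L(0) ≠ 0`, `3 ≤ q < c`, and assume the six
vanishing statements extracted from the admissibility of a centre of weights `(1/2, 1/3, 1/3, ≤ 1/c, …)`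
for `V² + U W² + Z^q` along a weight-`≤ 1/c` axis (orders `c`, `c/2`, `2c/3`, `2c/3`, `c/3`, `c/3` for
`f`, `∂_v f`, `ξ_u f`, `ξ_w f`, `ξ_u² f /2`, `ξ_w² f /2`).  If `2 ≠ 0` in `k` or `q` is odd, then the
LINEAR coefficients of `V, W, U, Z` all vanish. (derived here; the heart of the second-vertex theorem)
[cite: AbramovichTemkinWlodarczyk2024, Thm. 5.3.1 (2) (p. 1578), Lemma 5.2.10 (p. 1577);
Temkin2025, §1.2.2 (1) (p. 4)] -/
theorem axis_endgame {V W U Z L A B : Polynomial k} {c : ℚ} {q : ℕ} (hq : 3 ≤ q) (hqc : (q : ℚ) < c)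
    (h2q : (2 : k) ≠ 0 ∨ Odd q) (hL : L.coeff 0 ≠ 0)
    (hV0 : V.coeff 0 = 0) (hU0 : U.coeff 0 = 0) (hZ0 : Z.coeff 0 = 0)
    (hZ : VanBelow c (V ^ 2 + U * W ^ 2 + Z ^ q))
    (hEv : VanBelow (c / 2) (2 * V))
    (hE1u : VanBelow (2 * c / 3) (L * W ^ 2 - 2 * V * A))
    (hE1w : VanBelow (2 * c / 3) (2 * L * U * W - 2 * V * B))
    (hE2u : VanBelow (c / 3) (A ^ 2))
    (hE2w : VanBelow (c / 3) (B ^ 2 + L ^ 2 * U)) :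
    V.coeff 1 = 0 ∧ W.coeff 1 = 0 ∧ U.coeff 1 = 0 ∧ Z.coeff 1 = 0 := by
  have hq' : (3 : ℚ) ≤ q := by exact_mod_cast hq
  have hc3 : (3 : ℚ) < c := hq'.trans_lt hqc
  -- (1) `W` has order `≥ c/3`
  have hA : VanBelow (c / 6) A := by
    have := hE2u.of_sq; rwa [show c / 3 / 2 = c / 6 by ring] at this
  have hVA : VanBelow (2 * c / 3) (2 * V * A) := by
    have := hEv.mul hA; rwa [show c / 2 + c / 6 = 2 * c / 3 by ring] at this
  have hLW2 : VanBelow (2 * c / 3) (L * W ^ 2) := by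
    have := hE1u.add hVA; rwa [sub_add_cancel] at this
  have hW2 : VanBelow (2 * c / 3) (W ^ 2) := hLW2.of_mul_left hL
  have hW : VanBelow (c / 3) W := by
    have := hW2.of_sq; rwa [show 2 * c / 3 / 2 = c / 3 by ring] at this
  have hW1 : W.coeff 1 = 0 := hW 1 (by rw [Nat.cast_one]; linarith)
  -- (2) `V₁ = 0` from the `T²`-coefficient of `V² + U W² + Z^q`
  have hV1 : V.coeff 1 = 0 := by
    have h2 := hZ 2 (by norm_num; linarith)
    have hUW : (U * W ^ 2).coeff 2 = 0 := (hW2.mul_left U) 2 (by norm_num; linarith)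
    have hZq : (Z ^ q).coeff 2 = 0 :=
      ((vanBelow_one_of_coeff_zero hZ0).pow q) 2 (by rw [mul_one]; exact_mod_cast (show 2 < q by omega))
    rw [Polynomial.coeff_add, Polynomial.coeff_add, hUW, hZq, add_zero, add_zero, pow_two, Polynomial.coeff_mul,
      Finset.Nat.sum_antidiagonal_eq_sum_range_succ_mk] at h2
    simp only [Finset.sum_range_succ, Finset.sum_range_zero, hV0, zero_mul, mul_zero, zero_add, add_zero] at h2
    exact pow_eq_zero_iff two_ne_zero |>.1 (by rw [pow_two]; exact h2)
  -- (3) `B(0) = 0` and `U₁ = 0` from the `T⁰, T¹`-coefficients of `B² + L² U`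
  have hB0 : B.coeff 0 = 0 := by
    have h := hE2w 0 (by rw [Nat.cast_zero]; linarith)
    rw [Polynomial.coeff_add, Polynomial.mul_coeff_zero, hU0, mul_zero, add_zero, coeff_zero_pow'] at h
    exact pow_eq_zero_iff two_ne_zero |>.1 h
  have hU1 : U.coeff 1 = 0 := by
    have h := hE2w 1 (by rw [Nat.cast_one]; linarith)
    have hB2 : (B ^ 2).coeff 1 = 0 := ((vanBelow_one_of_coeff_zero hB0).pow 2) 1 (by norm_num)
    have hLU : (L ^ 2 * U).coeff 1 = L.coeff 0 ^ 2 * U.coeff 1 := by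
      rw [Polynomial.coeff_mul, Finset.Nat.sum_antidiagonal_eq_sum_range_succ_mk]
      simp only [Finset.sum_range_succ, Finset.sum_range_zero, hU0, mul_zero, zero_add, add_zero,
        coeff_zero_pow']
    rw [Polynomial.coeff_add, hB2, zero_add, hLU] at h
    exact (mul_eq_zero.1 h).resolve_left (pow_ne_zero 2 hL)
  refine ⟨hV1, hW1, hU1, ?_⟩
  -- (4) `Z₁ = 0`
  by_contra hZ1
  -- (★) `L²V² − B²W² + L²Z^q` vanishes below `c`
  have hstar : VanBelow c (L ^ 2 * V ^ 2 - B ^ 2 * W ^ 2 + L ^ 2 * Z ^ q) := by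
    have h1 : VanBelow c (L ^ 2 * (V ^ 2 + U * W ^ 2 + Z ^ q)) := hZ.mul_left _
    have h2 : VanBelow c ((B ^ 2 + L ^ 2 * U) * W ^ 2) := by
      have := hE2w.mul hW2; rwa [show c / 3 + 2 * c / 3 = c by ring] at this
    have h3 := h1.sub h2
    have e : L ^ 2 * V ^ 2 - B ^ 2 * W ^ 2 + L ^ 2 * Z ^ q =
        L ^ 2 * (V ^ 2 + U * W ^ 2 + Z ^ q) - (B ^ 2 + L ^ 2 * U) * W ^ 2 := by ring
    rw [e]; exact h3
  -- the `T^q`-coefficient of `L² Z^q` is `L(0)² Z₁^q ≠ 0`, the lower ones vanish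
  obtain ⟨Z', hZ'⟩ : Polynomial.X ∣ Z := Polynomial.X_dvd_iff.2 hZ0
  have hμ : Z'.coeff 0 = Z.coeff 1 := by rw [hZ']; simp
  have eLZ : L ^ 2 * Z ^ q = Polynomial.X ^ q * (L ^ 2 * Z' ^ q) := by rw [hZ']; ring
  have hLZq_q : (L ^ 2 * Z ^ q).coeff q = L.coeff 0 ^ 2 * Z.coeff 1 ^ q := by
    rw [eLZ, Polynomial.coeff_X_pow_mul', if_pos le_rfl, Nat.sub_self, Polynomial.mul_coeff_zero, coeff_zero_pow',
      coeff_zero_pow', hμ]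
  have hLZq_lt : ∀ n < q, (L ^ 2 * Z ^ q).coeff n = 0 := fun n hn => by
    rw [eLZ, Polynomial.coeff_X_pow_mul', if_neg (not_le.2 hn)]
  have hne : L.coeff 0 ^ 2 * Z.coeff 1 ^ q ≠ 0 := mul_ne_zero (pow_ne_zero _ hL) (pow_ne_zero _ hZ1)
  by_cases h2 : (2 : k) = 0
  · -- characteristic `2`, `q` odd: squares have no `T^q`-coefficient
    have hodd : Odd q := h2q.resolve_left (fun h => h h2)
    have h2' : (2 : Polynomial k) = 0 := by rw [← map_ofNat Polynomial.C 2, h2, map_zero]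
    have e : L ^ 2 * V ^ 2 - B ^ 2 * W ^ 2 + L ^ 2 * Z ^ q = (L * V + B * W) ^ 2 + L ^ 2 * Z ^ q := by
      linear_combination (-(B ^ 2 * W ^ 2) - L * V * B * W) * h2'
    rw [e] at hstar
    obtain ⟨m, hm⟩ := hodd
    have hsq : ((L * V + B * W) ^ 2).coeff q = 0 := by rw [hm]; exact coeff_sq_odd_eq_zero h2 _ m
    have := hstar q hqc
    rw [Polynomial.coeff_add, hLZq_q, hsq, zero_add] at this
    exact hne this
  · -- `2` invertible: compare `T`-adic orders
    have hV : VanBelow (c / 2) V := by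
      have h' : VanBelow (c / 2) (Polynomial.C (2 : k) * V) := by rwa [map_ofNat]
      exact h'.of_mul_left (by rw [Polynomial.coeff_C_zero]; exact h2)
    have hQ : VanBelow c (L ^ 2 * Z ^ q - B ^ 2 * W ^ 2) := by
      have hV2 : VanBelow c (L ^ 2 * V ^ 2) := by
        have := (hV.pow 2).mul_left (L ^ 2)
        rwa [show ((2 : ℕ) : ℚ) * (c / 2) = c by push_cast; ring] at this
      have h3 := hstar.sub hV2
      have e : L ^ 2 * Z ^ q - B ^ 2 * W ^ 2 = L ^ 2 * V ^ 2 - B ^ 2 * W ^ 2 + L ^ 2 * Z ^ q - L ^ 2 * V ^ 2 := by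
        ring
      rw [e]; exact h3
    have hBW_eq : ∀ n : ℕ, (n : ℚ) < c → ((B * W) ^ 2).coeff n = (L ^ 2 * Z ^ q).coeff n := by
      intro n hn
      have h3 := hQ n hn
      rw [Polynomial.coeff_sub, sub_eq_zero] at h3
      rw [show (B * W) ^ 2 = B ^ 2 * W ^ 2 by ring]; exact h3.symm
    have hBW_ne : B * W ≠ 0 := by
      intro h0
      have h3 := hBW_eq q hqc
      rw [h0, zero_pow two_ne_zero, Polynomial.coeff_zero, hLZq_q] at h3
      exact hne h3.symm
    have hB_ne : B ≠ 0 := left_ne_zero_of_mul hBW_ne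
    have hW_ne : W ≠ 0 := right_ne_zero_of_mul hBW_ne
    -- `2 · ord(BW) = q`
    set t := (B * W).natTrailingDegree with ht
    have hsq_ne : (B * W) ^ 2 ≠ 0 := pow_ne_zero _ hBW_ne
    have hntd2 : ((B * W) ^ 2).natTrailingDegree = 2 * t := by
      rw [pow_two, Polynomial.natTrailingDegree_mul hBW_ne hBW_ne, two_mul]
    have h2t : 2 * t = q := by
      apply le_antisymm
      · rw [← hntd2]
        apply Polynomial.natTrailingDegree_le_of_ne_zero
        rw [hBW_eq q hqc, hLZq_q]; exact hne
      · rw [← hntd2]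
        refine Polynomial.le_natTrailingDegree hsq_ne fun m hm => ?_
        have hmc : (m : ℚ) < c := lt_trans (by exact_mod_cast hm) hqc
        rw [hBW_eq m hmc]; exact hLZq_lt m hm
    have ht_eq : B.natTrailingDegree + W.natTrailingDegree = t := by
      rw [ht, Polynomial.natTrailingDegree_mul hB_ne hW_ne]
    have hω : c / 3 ≤ (W.natTrailingDegree : ℚ) := (vanBelow_iff_le_natTrailingDegree hW_ne).1 hW
    -- (★★) `B (B W + L V)` vanishes below `2c/3`
    have hD : VanBelow (2 * c / 3) (B * (B * W + L * V)) := by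
      have h1 : VanBelow (2 * c / 3) (L * U * W - V * B) := by
        have e : (2 : Polynomial k) * L * U * W - 2 * V * B = Polynomial.C (2 : k) * (L * U * W - V * B) := by
          rw [map_ofNat]; ring
        rw [e] at hE1w
        exact hE1w.of_mul_left (by rw [Polynomial.coeff_C_zero]; exact h2)
      have h1' : VanBelow (2 * c / 3) (L * (L * U * W - V * B)) := h1.mul_left L
      have h3 : VanBelow (2 * c / 3) ((B ^ 2 + L ^ 2 * U) * W) := by
        have := hE2w.mul hW; rwa [show c / 3 + c / 3 = 2 * c / 3 by ring] at this
      have h4 := h3.sub h1'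
      have e : B * (B * W + L * V) = (B ^ 2 + L ^ 2 * U) * W - L * (L * U * W - V * B) := by ring
      rw [e]; exact h4
    -- evaluate at degree `t + ord B < 2c/3`
    have hlt : ((t + B.natTrailingDegree : ℕ) : ℚ) < 2 * c / 3 := by
      have c1 : (B.natTrailingDegree : ℚ) + W.natTrailingDegree = t := by exact_mod_cast ht_eq
      have c2 : 2 * (t : ℚ) = q := by exact_mod_cast h2t
      push_cast; linarith
    have hDcoeff := hD _ hlt
    rw [mul_add, Polynomial.coeff_add] at hDcoeff
    have hBBW : (B * (B * W)).coeff (t + B.natTrailingDegree) ≠ 0 := by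
      rw [add_comm t, ht, Polynomial.coeff_mul_natTrailingDegree_add_natTrailingDegree]
      exact mul_ne_zero (Polynomial.trailingCoeff_nonzero_iff_nonzero.2 hB_ne)
        (Polynomial.trailingCoeff_nonzero_iff_nonzero.2 hBW_ne)
    have hBLV : (B * (L * V)).coeff (t + B.natTrailingDegree) ≠ 0 := by
      intro h0; rw [h0, add_zero] at hDcoeff; exact hBBW hDcoeff
    have hLV_ne : L * V ≠ 0 := by
      intro h0; rw [h0, mul_zero, Polynomial.coeff_zero] at hBLV; exact hBLV rfl
    have hV_ne : V ≠ 0 := right_ne_zero_of_mul hLV_ne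
    have hL_ne : L ≠ 0 := left_ne_zero_of_mul hLV_ne
    have hntdV : V.natTrailingDegree ≤ t := by
      have h1 := Polynomial.natTrailingDegree_le_of_ne_zero hBLV
      rw [Polynomial.natTrailingDegree_mul hB_ne hLV_ne, Polynomial.natTrailingDegree_mul hL_ne hV_ne] at h1
      omega
    have hVc : c / 2 ≤ (V.natTrailingDegree : ℚ) := (vanBelow_iff_le_natTrailingDegree hV_ne).1 hV
    have c2 : 2 * (t : ℚ) = q := by exact_mod_cast h2t
    have c3 : (V.natTrailingDegree : ℚ) ≤ t := by exact_mod_cast hntdV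
    linarith

end Endgame

/-! ## §5 Weights with invariant `(2, 3, 3, c, …)` -/

section Weights

/-- `(γ m)⁻¹ ∈ exps γ` for `γ m ≠ 0` (plumbing). [folklore] -/
private theorem inv_mem_exps₄ {γ : Fin N → ℚ} {m : Fin N} (hm : γ m ≠ 0) : (γ m)⁻¹ ∈ exps γ := by
  unfold exps
  rw [List.mem_insertionSort, List.mem_map]
  exact ⟨m, Finset.mem_toList.2 (Finset.mem_filter.2 ⟨Finset.mem_univ _, hm⟩), rfl⟩

/-- **Weights of a centre with invariant `(2, 3, 3, c, …)`, `c > 3`**: one weight `1/2`, two weights `1/3`,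
all others `≤ 1/c`. (derived here) [cite: AbramovichTemkinWlodarczyk2024, §5.1 (p. 1575) (the invariant lists
the exponents `1/γ_i` increasingly)] -/
theorem weights_of_exps_eq_cons₄ {γ : Fin N → ℚ} {c : ℚ} {rest : List ℚ}
    (h : exps γ = (2 : ℚ) :: 3 :: 3 :: c :: rest) (hc : 3 < c) (hγ : ∀ m, 0 ≤ γ m) :
    ∃ a b₁ b₂ : Fin N, a ≠ b₁ ∧ a ≠ b₂ ∧ b₁ ≠ b₂ ∧ γ a = 1 / 2 ∧ γ b₁ = 1 / 3 ∧ γ b₂ = 1 / 3 ∧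
      ∀ m, m ≠ a → m ≠ b₁ → m ≠ b₂ → γ m ≤ 1 / c := by
  classical
  have hc0 : (0 : ℚ) < c := by linarith
  have hrest : ∀ x ∈ rest, c ≤ x := by
    have hs := exps_sorted γ
    rw [h] at hs
    simp only [List.pairwise_cons, List.mem_cons] at hs
    exact hs.2.2.2.1
  -- the possible values of a non-zero weight
  have hval : ∀ m, γ m ≠ 0 → γ m = 1 / 2 ∨ γ m = 1 / 3 ∨ γ m ≤ 1 / c := by
    intro m hm
    have hpos : 0 < γ m := lt_of_le_of_ne (hγ m) (Ne.symm hm)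
    have hmem := inv_mem_exps₄ hm
    rw [h] at hmem
    simp only [List.mem_cons] at hmem
    rcases hmem with h2 | h3 | h3 | hc' | hr
    · left; rw [← inv_inv (γ m), h2]; norm_num
    · right; left; rw [← inv_inv (γ m), h3]; norm_num
    · right; left; rw [← inv_inv (γ m), h3]; norm_num
    · right; right; rw [← inv_inv (γ m), hc', inv_eq_one_div]
    · right; right
      have hle := hrest _ hr
      rw [← inv_inv (γ m), inv_eq_one_div]
      exact one_div_le_one_div_of_le hc0 hle
  -- inverse bounds
  have hinv2 : ∀ m, γ m ≠ 0 → (γ m)⁻¹ ≤ 2 → γ m = 1 / 2 := by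
    intro m hm hle
    have h1 := mul_le_mul_of_nonneg_right hle (hγ m)
    rw [inv_mul_cancel₀ hm] at h1
    rcases hval m hm with h2 | h3 | hc'
    · exact h2
    · exfalso; rw [h3] at h1; norm_num at h1
    · exfalso
      have : γ m * c ≤ 1 := by
        have := mul_le_mul_of_nonneg_right hc' hc0.le
        rwa [one_div_mul_cancel hc0.ne'] at this
      nlinarith
  have hinv3 : ∀ m, γ m ≠ 0 → (γ m)⁻¹ ≤ 3 → γ m = 1 / 2 ∨ γ m = 1 / 3 := by
    intro m hm hle
    have h1 := mul_le_mul_of_nonneg_right hle (hγ m)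
    rw [inv_mul_cancel₀ hm] at h1
    rcases hval m hm with h2 | h3 | hc'
    · exact Or.inl h2
    · exact Or.inr h3
    · exfalso
      have : γ m * c ≤ 1 := by
        have := mul_le_mul_of_nonneg_right hc' hc0.le
        rwa [one_div_mul_cancel hc0.ne'] at this
      nlinarith
  -- counting
  have hr2 : rest.countP (fun x => decide (x ≤ 2)) = 0 := List.countP_eq_zero.2 fun x hx => by
    simp only [decide_eq_true_eq, not_le]; linarith [hrest x hx]
  have hr3 : rest.countP (fun x => decide (x ≤ 3)) = 0 := List.countP_eq_zero.2 fun x hx => by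
    simp only [decide_eq_true_eq, not_le]; linarith [hrest x hx]
  have hc2 : ¬ c ≤ 2 := by linarith
  have hc3 : ¬ c ≤ 3 := not_le.2 hc
  have hcount2 : (Finset.univ.filter fun m => γ m ≠ 0 ∧ (γ m)⁻¹ ≤ 2).card = 1 := by
    rw [← countP_exps, h]
    simp only [List.countP_cons, hr2, decide_eq_true_eq]
    norm_num [hc2]
  have hcount3 : (Finset.univ.filter fun m => γ m ≠ 0 ∧ (γ m)⁻¹ ≤ 3).card = 3 := by
    rw [← countP_exps, h]
    simp only [List.countP_cons, hr3, decide_eq_true_eq]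
    norm_num [hc3]
  have hset2 : (Finset.univ.filter fun m => γ m ≠ 0 ∧ (γ m)⁻¹ ≤ 2) =
      Finset.univ.filter fun m => γ m = 1 / 2 := by
    ext m
    simp only [Finset.mem_filter, Finset.mem_univ, true_and]
    constructor
    · rintro ⟨hm, hle⟩; exact hinv2 m hm hle
    · intro h2; rw [h2]; norm_num
  have hset3 : (Finset.univ.filter fun m => γ m ≠ 0 ∧ (γ m)⁻¹ ≤ 3) =
      (Finset.univ.filter fun m => γ m = 1 / 2) ∪ Finset.univ.filter fun m => γ m = 1 / 3 := by
    ext m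
    simp only [Finset.mem_filter, Finset.mem_union, Finset.mem_univ, true_and]
    constructor
    · rintro ⟨hm, hle⟩; exact hinv3 m hm hle
    · rintro (h2 | h3)
      · rw [h2]; norm_num
      · rw [h3]; norm_num
  rw [hset2] at hcount2
  have hdisj : Disjoint (Finset.univ.filter fun m => γ m = 1 / 2) (Finset.univ.filter fun m => γ m = 1 / 3) :=
    Finset.disjoint_filter.2 fun m _ h2 h3 => by rw [h2] at h3; norm_num at h3
  rw [hset3, Finset.card_union_of_disjoint hdisj, hcount2] at hcount3
  have hT3 : (Finset.univ.filter fun m => γ m = 1 / 3).card = 2 := by omega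
  obtain ⟨a, ha⟩ := Finset.card_eq_one.1 hcount2
  obtain ⟨b₁, b₂, hb, hb12⟩ := Finset.card_eq_two.1 hT3
  have hγa : γ a = 1 / 2 := by
    have : a ∈ Finset.univ.filter fun m => γ m = 1 / 2 := by rw [ha]; exact Finset.mem_singleton_self a
    simpa using this
  have hγb : ∀ b, b ∈ ({b₁, b₂} : Finset (Fin N)) → γ b = 1 / 3 := fun b hb' => by
    have : b ∈ Finset.univ.filter fun m => γ m = 1 / 3 := by rw [hb12]; exact hb'
    simpa using this
  have hγb₁ := hγb b₁ (by simp)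
  have hγb₂ := hγb b₂ (by simp)
  refine ⟨a, b₁, b₂, ?_, ?_, hb, hγa, hγb₁, hγb₂, fun m hma hmb₁ hmb₂ => ?_⟩
  · rintro rfl; rw [hγa] at hγb₁; norm_num at hγb₁
  · rintro rfl; rw [hγa] at hγb₂; norm_num at hγb₂
  · by_cases hm : γ m = 0
    · rw [hm]; positivity
    rcases hval m hm with h2 | h3 | hc'
    · exfalso; apply hma
      have : m ∈ Finset.univ.filter fun m => γ m = 1 / 2 := by simp [h2]
      rw [ha] at this; exact Finset.mem_singleton.1 this
    · exfalso
      have : m ∈ Finset.univ.filter fun m => γ m = 1 / 3 := by simp [h3]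
      rw [hb12, Finset.mem_insert, Finset.mem_singleton] at this
      rcases this with h | h
      · exact hmb₁ h
      · exact hmb₂ h
    · exact hc'

end Weights

/-! ## §6 The apex variable of a vertex centre is `v` to first order -/

section Apex

variable {i j l e : Fin N} {q : ℕ}

/-- A polynomial in the span of the `X_m`, `m ∈ S`, has no `X_y`-coefficient for `y ∉ S` (plumbing).
[folklore] -/
private theorem coeff_single_eq_zero_of_mem_span₄ {S : Finset (Fin N)} {P : MvPolynomial (Fin N) k}
    (hP : P ∈ Submodule.span k ((fun m => (X m : MvPolynomial (Fin N) k)) '' (S : Set (Fin N))))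
    {y : Fin N} (hy : y ∉ S) : coeff (Finsupp.single y 1) P = 0 := by
  classical
  induction hP using Submodule.span_induction with
  | mem x hx =>
    obtain ⟨m, hm, rfl⟩ := hx
    rw [coeff_X, if_neg]
    intro h
    have := Finsupp.single_left_injective one_ne_zero h
    exact hy (this ▸ hm)
  | zero => simp
  | add x y _ _ hx hy => rw [coeff_add, hx, hy, add_zero]
  | smul a x _ hx => rw [coeff_smul, hx, smul_zero]

/-- **The apex variable is `v` to first order.**  If `(Ψ, γ)` is a centre for `f = X_i² + X_l X_j² + X_e^q`
(`q ≥ 3`) with a unique weight `1/2` (at `a`) and all weights `≤ 1/2`, then the linear part of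
`v' = Ψ(X_a)` is `λ X_i` with `λ ≠ 0` (directrix of `in₂ f = X_i²` plus the Jacobian criterion).
(derived here) [cite: AbramovichTemkinWlodarczyk2024, proof of Thm. 5.3.1 (2)–(3) (p. 1578), Lemma 5.2.10
(p. 1577); CossartJannsenSaito2020, Def. 7.1 (p. 107)] -/
theorem coeff_single_apex (hij : i ≠ j) (hil : i ≠ l) (hie : i ≠ e) (hjl : j ≠ l) (hle : l ≠ e)
    (hq : 3 ≤ q) {Ψ : MvPolynomial (Fin N) k ≃ₐ[k] MvPolynomial (Fin N) k} {γ : Fin N → ℚ}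
    (hc : IsCentreFor (umbrellaPow k i j l e q) Ψ γ) {a : Fin N} (hγa : γ a = 1 / 2)
    (hle2 : ∀ m, γ m ≤ 1 / 2) (huniq : ∀ m, γ m = 1 / 2 → m = a) :
    (∀ y, y ≠ i → coeff (Finsupp.single y 1) (Ψ (X a)) = 0) ∧
      coeff (Finsupp.single i 1) (Ψ (X a)) ≠ 0 := by
  classical
  set f := umbrellaPow k i j l e q with hf
  have hord : monomialOrd (fun _ => 1) f = 2 := monomialOrd_umbrellaPow hil hie hjl (by omega)
  have hin : homogeneousComponent 2 f = X i ^ 2 := homogeneousComponent_umbrellaPow (by omega)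
  have hτ : hironakaTau k {homogeneousComponent 2 f} = 1 := by rw [hin]; exact hironakaTau_X_pow i two_ne_zero
  have hinv : ((2 : ℕ) : ℚ)⁻¹ = 1 / 2 := by norm_num
  have hle' : ∀ m, γ m ≤ ((2 : ℕ) : ℚ)⁻¹ := fun m => by rw [hinv]; exact hle2 m
  have hfilt : (Finset.univ.filter fun m => γ m = ((2 : ℕ) : ℚ)⁻¹) = {a} := by
    ext m
    simp only [Finset.mem_filter, Finset.mem_univ, true_and, Finset.mem_singleton, hinv]
    exact ⟨huniq m, fun h => h ▸ hγa⟩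
  have hset : {m | γ m = ((2 : ℕ) : ℚ)⁻¹} = {a} := by
    ext m
    simp only [Set.mem_setOf_eq, Set.mem_singleton_iff, hinv]
    exact ⟨huniq m, fun h => h ▸ hγa⟩
  have h1 := directrix_eq_span_of_isCentreFor hord hc hle' (by rw [hfilt, Finset.card_singleton, hτ])
  rw [hset, Set.image_singleton] at h1
  have hFS : ∀ d ∈ (homogeneousComponent 2 f).support, ∀ y ∉ ({i} : Finset (Fin N)), d y = 0 := by
    intro d hd y hy
    rw [hin, X_pow_eq_monomial, support_monomial, if_neg one_ne_zero, Finset.mem_singleton] at hd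
    rw [hd, Finsupp.single_apply, if_neg]
    rintro rfl
    exact hy (Finset.mem_singleton_self _)
  have h2 := directrix_eq_comap_span_X hord two_pos (by rw [Finset.card_singleton, hτ]) hFS
    (hironakaDelta_umbrellaPow hij hil hie hjl hle hq)
  rw [h2] at h1
  have hT1 : Submodule.span k ((fun m => (X m : MvPolynomial (Fin N) k)) '' ((({i} : Finset (Fin N)) :
      Set (Fin N)))) ≤ homogeneousSubmodule (Fin N) k 1 :=
    Submodule.span_le.mpr (by
      rintro _ ⟨m, _, rfl⟩; exact (mem_homogeneousSubmodule 1 _).mpr (isHomogeneous_X k m))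
  have hT2 : Submodule.span k {homogeneousComponent 1 (Ψ (X a))} ≤ homogeneousSubmodule (Fin N) k 1 :=
    Submodule.span_le.mpr (by
      intro x hx
      rw [Set.mem_singleton_iff] at hx
      rw [hx]
      exact homogeneousComponent_mem 1 _)
  have h3 := congrArg (Submodule.map (linearFormPolyₗ k)) h1
  rw [map_comap_linearFormPolyₗ k hT1, map_comap_linearFormPolyₗ k hT2] at h3
  have hmem : homogeneousComponent 1 (Ψ (X a)) ∈ Submodule.span k ((fun m => (X m : MvPolynomial (Fin N) k)) ''
      ((({i} : Finset (Fin N)) : Set (Fin N)))) := by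
    rw [h3]; exact Submodule.subset_span rfl
  have hD : ∀ y, y ≠ i → coeff (Finsupp.single y 1) (Ψ (X a)) = 0 := by
    intro y hy
    have := coeff_single_eq_zero_of_mem_span₄ hmem (show y ∉ ({i} : Finset (Fin N)) by simpa using hy)
    rwa [coeff_homogeneousComponent, if_pos (by simp [Finsupp.degree_single])] at this
  refine ⟨hD, ?_⟩
  -- Jacobian criterion: `Σ_m ∂(ΨX_a)/∂X_m(0) · ∂(Ψ⁻¹X_m)/∂X_a(0) = 1`
  have hmon : ∀ m, (((fun _ => 1 : Fin N → ℕ) m : ℕ) : ℕ∞) ≤ monomialOrd (fun _ => 1) (Ψ.symm (X m)) :=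
    fun m => by
      rw [Nat.cast_one]
      exact one_le_monomialOrd_one_of_constantCoeff_eq_zero _ (constantCoeff_symm_X_eq_zero_of_forall Ψ hc.1 m)
  have key := sum_jacobianBlock_symm_mul_jacobianBlock (fun _ : Fin N => (1 : ℕ)) (fun _ => Nat.one_pos) Ψ.symm
    hmon (i := a) (l := a) rfl
  rw [AlgEquiv.symm_symm, Finset.filter_true_of_mem (fun _ _ => rfl), if_pos rfl,
    Finset.sum_eq_single i (fun m _ hm => by rw [hD m hm, zero_mul]) (fun h => absurd (Finset.mem_univ _) h)]
    at key
  intro h0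
  rw [h0, zero_mul] at key
  exact zero_ne_one key

end Apex

/-! ## §7 The second vertex -/

section SecondVertex

variable {i j l e : Fin N} {q : ℕ}

/-- **Axis lemma.**  Let `(Ψ, γ)` be a centre for `f = X_i² + X_l X_j² + X_e^q` (`3 ≤ q < c`, `2 ≠ 0` in `k`
or `q` odd) with weights `γ a = 1/2`, `γ b₁ = γ b₂ = 1/3` and all other weights `≤ 1/c`.  Then along every
other axis `X_{e₁}` the linear `X_{e₁}`-coefficients of `Ψ⁻¹ v, Ψ⁻¹ w, Ψ⁻¹ u, Ψ⁻¹ z` vanish.  (Taylor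
expansions along the vector fields `∂_v` and `ξ_x = (∂_v v') ∂_x − (∂_x v') ∂_v`, `x ∈ {w, u}`, which are
tangent to `{v' = 0}`; admissibility transfers to weighted vanishing in `k[T][ε]`; then `axis_endgame`.)
(derived here) [cite: AbramovichTemkinWlodarczyk2024, Thm. 5.3.1 (2) (p. 1578), Lemma 5.2.10 (p. 1577);
Temkin2025, §1.2.2 (1) (p. 4); CossartJannsenSaito2020, Def. 1.26] -/
theorem coeff_single_symm_eq_zero_of_vertex (hij : i ≠ j) (hil : i ≠ l) (hie : i ≠ e) (hjl : j ≠ l)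
    (hje : j ≠ e) (hle : l ≠ e) (hq : 3 ≤ q) (h2q : (2 : k) ≠ 0 ∨ Odd q)
    {Ψ : MvPolynomial (Fin N) k ≃ₐ[k] MvPolynomial (Fin N) k} {γ : Fin N → ℚ}
    (hc : IsCentreFor (umbrellaPow k i j l e q) Ψ γ) {a b₁ b₂ : Fin N} (hγa : γ a = 1 / 2)
    (hγb₁ : γ b₁ = 1 / 3) (hγb₂ : γ b₂ = 1 / 3) {c : ℚ} (hqc : (q : ℚ) < c)
    (hE : ∀ m, m ≠ a → m ≠ b₁ → m ≠ b₂ → γ m ≤ 1 / c) {e₁ : Fin N} (he₁a : e₁ ≠ a)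
    (he₁b₁ : e₁ ≠ b₁) (he₁b₂ : e₁ ≠ b₂) {x : Fin N} (hx : x = i ∨ x = j ∨ x = l ∨ x = e) :
    coeff (Finsupp.single e₁ 1) (Ψ.symm (X x)) = 0 := by
  classical
  set f := umbrellaPow k i j l e q with hf
  have hq3 : (3 : ℚ) ≤ q := by exact_mod_cast hq
  have hc3 : (3 : ℚ) < c := hq3.trans_lt hqc
  have hc0 : (0 : ℚ) < c := by linarith
  -- derived weight facts
  have h1c : 1 / c ≤ (1 : ℚ) / 2 := one_div_le_one_div_of_le (by norm_num) (by linarith)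
  have hle2 : ∀ m, γ m ≤ 1 / 2 := by
    intro m
    by_cases hma : m = a
    · rw [hma, hγa]
    by_cases hm1 : m = b₁
    · rw [hm1, hγb₁]; norm_num
    by_cases hm2 : m = b₂
    · rw [hm2, hγb₂]; norm_num
    exact (hE m hma hm1 hm2).trans h1c
  have huniq : ∀ m, γ m = 1 / 2 → m = a := by
    intro m hm
    by_contra hma
    by_cases hm1 : m = b₁
    · rw [hm1, hγb₁] at hm; norm_num at hm
    by_cases hm2 : m = b₂
    · rw [hm2, hγb₂] at hm; norm_num at hm
    have h := hE m hma hm1 hm2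
    rw [hm] at h
    have h' := mul_le_mul_of_nonneg_left h (by linarith : (0 : ℚ) ≤ 2 * c)
    rw [show 2 * c * (1 / 2) = c by ring, show 2 * c * (1 / c) = 2 by field_simp] at h'
    linarith
  obtain ⟨hD, hLi⟩ := coeff_single_apex hij hil hie hjl hle hq hc hγa hle2 huniq
  -- the axis restriction `ρ = (X_{e₁} ↦ T, others ↦ 0) ∘ Ψ⁻¹`
  obtain ⟨ρ, hρ⟩ : ∃ ρ : MvPolynomial (Fin N) k →ₐ[k] Polynomial k, ∀ p, ρ p = axisHom e₁ (Ψ.symm p) :=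
    ⟨(axisHom e₁).comp (Ψ.symm : MvPolynomial (Fin N) k →ₐ[k] MvPolynomial (Fin N) k), fun _ => rfl⟩
  have hρΨ : ∀ m, ρ (Ψ (X m)) = if m = e₁ then Polynomial.X else 0 := fun m => by
    rw [hρ, AlgEquiv.symm_apply_apply, axisHom_X]
  have hρ0 : ∀ P, (ρ P).coeff 0 = constantCoeff P := fun P => by
    rw [hρ, coeff_zero_axisHom, constantCoeff_map_of_fix Ψ.symm (constantCoeff_symm_X_eq_zero_of_forall Ψ hc.1)]
  have hρ1 : ∀ P, (ρ P).coeff 1 = coeff (Finsupp.single e₁ 1) (Ψ.symm P) := fun P => by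
    rw [hρ, coeff_one_axisHom]
  set v' := Ψ (X a) with hv'
  set V := ρ (X i) with hV
  set W := ρ (X j) with hW
  set U := ρ (X l) with hU
  set Z := ρ (X e) with hZ
  set L := ρ (pderiv i v') with hL'
  set B := ρ (pderiv j v') with hB
  set A := ρ (pderiv l v') with hA
  have hV0 : V.coeff 0 = 0 := by rw [hV, hρ0, constantCoeff_X]
  have hU0 : U.coeff 0 = 0 := by rw [hU, hρ0, constantCoeff_X]
  have hZ0 : Z.coeff 0 = 0 := by rw [hZ, hρ0, constantCoeff_X]
  have hL : L.coeff 0 ≠ 0 := by rw [hL', hρ0, constantCoeff_pderiv]; exact hLi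
  have hρv' : ρ v' = 0 := by rw [hv', hρΨ, if_neg (Ne.symm he₁a)]
  -- scaled weights `γ' = c·γ` and admissibility of `g = Ψ⁻¹ f`
  set g := Ψ.symm f with hg
  have hfg : f = Ψ g := by rw [hg, AlgEquiv.apply_symm_apply]
  have hadm : ∀ d ∈ g.support, c ≤ monomialValuation (fun m => c * γ m) d := by
    intro d hd
    have h1 : (1 : ℚ) ≤ monomialValuation γ d := hc.2.2 d hd
    have : monomialValuation (fun m => c * γ m) d = c * monomialValuation γ d := by
      rw [monomialValuation_eq_sum_univ', monomialValuation_eq_sum_univ', Finset.mul_sum]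
      exact Finset.sum_congr rfl fun m _ => by ring
    rw [this]; nlinarith
  -- weights of the Taylor images of the centre variables
  have hweights : ∀ (ξ : Fin N → MvPolynomial (Fin N) k) (α : ℚ), 1 ≤ α → c / 3 ≤ α →
      VanBelow₂ α 1 (c * γ a) (fieldTaylor ρ ξ v') →
      ∀ m, VanBelow₂ α 1 (c * γ m) (fieldTaylor ρ ξ (Ψ (X m))) := by
    intro ξ α h1α hα3 ha m
    have hα0 : (0 : ℚ) ≤ α := by linarith
    by_cases hma : m = a
    · rw [hma]; exact ha
    by_cases hmb : m = b₁ ∨ m = b₂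
    · have hm0 : ρ (Ψ (X m)) = 0 := by
        rw [hρΨ, if_neg]
        rintro rfl
        rcases hmb with h | h
        · exact he₁b₁ h
        · exact he₁b₂ h
      have h := VanBelow₂.of_X_pow_dvd (P := fieldTaylor ρ ξ (Ψ (X m))) hα0 zero_le_one (m := 1)
        (by simpa only [pow_one] using X_dvd_fieldTaylor hm0)
      rw [Nat.cast_one, one_mul] at h
      refine h.mono ?_
      rcases hmb with h | h
      · rw [h, hγb₁]; linarith
      · rw [h, hγb₂]; linarith
    · push Not at hmb
      have hγm : c * γ m ≤ 1 := by
        have := mul_le_mul_of_nonneg_left (hE m hma hmb.1 hmb.2) hc0.le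
        rwa [mul_one_div_cancel hc0.ne'] at this
      refine VanBelow₂.of_coeff_coeff_zero hα0 zero_le_one (hγm.trans h1α) hγm ?_
      rw [coeff_zero_fieldTaylor, hρΨ]
      split_ifs
      · exact Polynomial.coeff_X_zero
      · exact Polynomial.coeff_zero 0
  -- transfer of admissibility: `Taylor(f)` has weighted order `≥ c`
  have htransfer : ∀ (ξ : Fin N → MvPolynomial (Fin N) k) (α : ℚ), 1 ≤ α → c / 3 ≤ α →
      VanBelow₂ α 1 (c * γ a) (fieldTaylor ρ ξ v') → VanBelow₂ α 1 c (fieldTaylor ρ ξ f) := by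
    intro ξ α h1α hα3 ha
    have hα0 : (0 : ℚ) ≤ α := by linarith
    have h := VanBelow₂.map_of_le_monomialValuation hα0 zero_le_one
      ((fieldTaylor ρ ξ).comp (Ψ : MvPolynomial (Fin N) k →ₐ[k] MvPolynomial (Fin N) k))
      (γ := fun m => c * γ m) (fun m => hweights ξ α h1α hα3 ha m) hadm
    have h' : VanBelow₂ α 1 c (fieldTaylor ρ ξ (Ψ g)) := h
    rwa [← hfg] at h'
  -- (a) the direction `∂_v`
  set ξv : Fin N → MvPolynomial (Fin N) k := fun m => if m = i then 1 else 0 with hξv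
  have hTv : VanBelow₂ (c / 2) 1 c (fieldTaylor ρ ξv f) := by
    refine htransfer ξv (c / 2) (by linarith) (by linarith) ?_
    have h := VanBelow₂.of_X_pow_dvd (P := fieldTaylor ρ ξv v') (by linarith : (0 : ℚ) ≤ c / 2) zero_le_one
      (m := 1) (by simpa only [pow_one] using X_dvd_fieldTaylor hρv')
    rw [Nat.cast_one, one_mul] at h
    refine h.mono ?_
    rw [hγa]; linarith
  have hexp_v : fieldTaylor ρ ξv f = Polynomial.C (V ^ 2 + U * W ^ 2 + Z ^ q) + Polynomial.C (2 * V) * Polynomial.X +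
      Polynomial.C 1 * Polynomial.X ^ 2 := by
    have e1 : ξv i = 1 := by simp [hξv]
    have e2 : ξv j = 0 := by simp [hξv, hij.symm]
    have e3 : ξv l = 0 := by simp [hξv, hil.symm]
    have e4 : ξv e = 0 := by simp [hξv, hie.symm]
    rw [hf, umbrellaPow_eq]
    simp only [map_add, map_mul, map_pow, fieldTaylor_X, e1, e2, e3, e4, map_one, map_zero, mul_zero, add_zero]
    simp only [map_ofNat]
    ring
  have hEv : VanBelow (c / 2) (2 * V) := fun n hn => by
    have h := hTv 1 n (by rw [Nat.cast_one, one_mul, mul_one]; linarith)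
    rwa [hexp_v, (coeff_normalForm _ _ _).2.1] at h
  -- (b) the direction `ξ_u = (∂_v v') ∂_u − (∂_u v') ∂_v`
  set ξu := pairField i l (-pderiv l v') (pderiv i v') with hξu
  have hTu : VanBelow₂ (c / 3) 1 c (fieldTaylor ρ ξu f) := by
    refine htransfer ξu (c / 3) (by linarith) le_rfl ?_
    have hsum : ∑ m, ξu m * pderiv m v' = 0 := by rw [hξu, sum_pairField_mul hil]; ring
    have h := VanBelow₂.of_X_pow_dvd (P := fieldTaylor ρ ξu v') (by linarith : (0 : ℚ) ≤ c / 3) zero_le_one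
      (m := 2) (X_sq_dvd_fieldTaylor hρv' (by rw [hsum, map_zero]))
    refine h.mono ?_
    rw [hγa]; push_cast; linarith
  have hexp_u : fieldTaylor ρ ξu f = Polynomial.C (V ^ 2 + U * W ^ 2 + Z ^ q) +
      Polynomial.C (L * W ^ 2 - 2 * V * A) * Polynomial.X + Polynomial.C (A ^ 2) * Polynomial.X ^ 2 := by
    have e1 : ξu i = -pderiv l v' := by simp [hξu, pairField]
    have e2 : ξu l = pderiv i v' := by simp [hξu, pairField, hil.symm]
    have e3 : ξu j = 0 := by simp [hξu, pairField, hij.symm, hjl]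
    have e4 : ξu e = 0 := by simp [hξu, pairField, hie.symm, hle.symm]
    rw [hf, umbrellaPow_eq]
    simp only [map_add, map_mul, map_pow, fieldTaylor_X, e1, e2, e3, e4, map_neg, map_zero, mul_zero, add_zero]
    simp only [map_sub, map_mul, map_pow, map_ofNat]
    ring
  have hZvan : VanBelow c (V ^ 2 + U * W ^ 2 + Z ^ q) := fun n hn => by
    have h := hTu 0 n (by rw [Nat.cast_zero, zero_mul, zero_add, mul_one]; exact hn)
    rwa [hexp_u, (coeff_normalForm _ _ _).1] at h
  have hE1u : VanBelow (2 * c / 3) (L * W ^ 2 - 2 * V * A) := fun n hn => by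
    have h := hTu 1 n (by rw [Nat.cast_one, one_mul, mul_one]; linarith)
    rwa [hexp_u, (coeff_normalForm _ _ _).2.1] at h
  have hE2u : VanBelow (c / 3) (A ^ 2) := fun n hn => by
    have h := hTu 2 n (by rw [Nat.cast_two, mul_one]; linarith)
    rwa [hexp_u, (coeff_normalForm _ _ _).2.2] at h
  -- (c) the direction `ξ_w = (∂_v v') ∂_w − (∂_w v') ∂_v`
  set ξw := pairField i j (-pderiv j v') (pderiv i v') with hξw
  have hTw : VanBelow₂ (c / 3) 1 c (fieldTaylor ρ ξw f) := by
    refine htransfer ξw (c / 3) (by linarith) le_rfl ?_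
    have hsum : ∑ m, ξw m * pderiv m v' = 0 := by rw [hξw, sum_pairField_mul hij]; ring
    have h := VanBelow₂.of_X_pow_dvd (P := fieldTaylor ρ ξw v') (by linarith : (0 : ℚ) ≤ c / 3) zero_le_one
      (m := 2) (X_sq_dvd_fieldTaylor hρv' (by rw [hsum, map_zero]))
    refine h.mono ?_
    rw [hγa]; push_cast; linarith
  have hexp_w : fieldTaylor ρ ξw f = Polynomial.C (V ^ 2 + U * W ^ 2 + Z ^ q) +
      Polynomial.C (2 * L * U * W - 2 * V * B) * Polynomial.X + Polynomial.C (B ^ 2 + L ^ 2 * U) * Polynomial.X ^ 2 := by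
    have e1 : ξw i = -pderiv j v' := by simp [hξw, pairField]
    have e2 : ξw j = pderiv i v' := by simp [hξw, pairField, hij.symm]
    have e3 : ξw l = 0 := by simp [hξw, pairField, hil.symm, Ne.symm hjl]
    have e4 : ξw e = 0 := by simp [hξw, pairField, hie.symm, Ne.symm hje]
    rw [hf, umbrellaPow_eq]
    simp only [map_add, map_mul, map_pow, fieldTaylor_X, e1, e2, e3, e4, map_neg, map_zero, mul_zero, add_zero]
    simp only [map_sub, map_mul, map_ofNat]
    ring
  have hE1w : VanBelow (2 * c / 3) (2 * L * U * W - 2 * V * B) := fun n hn => by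
    have h := hTw 1 n (by rw [Nat.cast_one, one_mul, mul_one]; linarith)
    rwa [hexp_w, (coeff_normalForm _ _ _).2.1] at h
  have hE2w : VanBelow (c / 3) (B ^ 2 + L ^ 2 * U) := fun n hn => by
    have h := hTw 2 n (by rw [Nat.cast_two, mul_one]; linarith)
    rwa [hexp_w, (coeff_normalForm _ _ _).2.2] at h
  -- the endgame
  obtain ⟨hV1, hW1, hU1, hZ1⟩ := axis_endgame hq hqc h2q hL hV0 hU0 hZ0 hZvan hEv hE1u hE1w hE2u hE2w
  rw [← hρ1]
  rcases hx with rfl | rfl | rfl | rfl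
  exacts [hV1, hW1, hU1, hZ1]

/-- **Second vertex, weight form.**  For `f = X_i² + X_l X_j² + X_e^q` (`i, j, l, e` distinct, spectators
allowed, `3 ≤ q < c`, and `2 ≠ 0` in `k` or `q` odd) there is NO centre `(Ψ, γ)` — `Ψ` ANY polynomial
automorphism fixing the origin — with weights `γ a = 1/2`, `γ b₁ = γ b₂ = 1/3` and all other weights `≤ 1/c`:
the point centre `(v', w', u', z'^{1/c})` with `c > q` is not admissible.  (By the axis lemma the rows
`v, w, u, z` of the Jacobian of `Ψ⁻¹` at `0` are supported on the three columns `a, b₁, b₂` — rank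
contradiction, as in `WeightedCentreSecondFaceSpectators`.)  The hypothesis `2 ≠ 0 ∨ q odd` is needed: in
characteristic `2` with `q` even, `f = (X_i + X_e^{q/2})² + X_l X_j²` admits `(2, 3, 3, c)` for every `c`.
(derived here) [cite: AbramovichTemkinWlodarczyk2024, Thm. 5.3.1 (2) (p. 1578), Lemma 5.2.10 (p. 1577);
Temkin2025, §1.2.2 (1) (p. 4)] -/
theorem not_isCentreFor_umbrellaPow_vertex (hij : i ≠ j) (hil : i ≠ l) (hie : i ≠ e) (hjl : j ≠ l)
    (hje : j ≠ e) (hle : l ≠ e) (hq : 3 ≤ q) (h2q : (2 : k) ≠ 0 ∨ Odd q)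
    {Ψ : MvPolynomial (Fin N) k ≃ₐ[k] MvPolynomial (Fin N) k} {γ : Fin N → ℚ} {a b₁ b₂ : Fin N}
    (hγa : γ a = 1 / 2) (hγb₁ : γ b₁ = 1 / 3) (hγb₂ : γ b₂ = 1 / 3) {c : ℚ} (hqc : (q : ℚ) < c)
    (hE : ∀ m, m ≠ a → m ≠ b₁ → m ≠ b₂ → γ m ≤ 1 / c) :
    ¬ IsCentreFor (umbrellaPow k i j l e q) Ψ γ := by
  classical
  intro hc
  set S : Finset (Fin N) := {a, b₁, b₂} with hS
  have hS3 : S.card ≤ 3 := Finset.card_le_three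
  have hoff : ∀ d, d ∉ S → ∀ x, (x = i ∨ x = j ∨ x = l ∨ x = e) →
      coeff (Finsupp.single d 1) (Ψ.symm (X x)) = 0 := by
    intro d hd x hx
    simp only [hS, Finset.mem_insert, Finset.mem_singleton, not_or] at hd
    exact coeff_single_symm_eq_zero_of_vertex hij hil hie hjl hje hle hq h2q hc hγa hγb₁ hγb₂ hqc hE hd.1 hd.2.1
      hd.2.2 hx
  -- rank contradiction
  have hmon : ∀ m, (((fun _ => 1 : Fin N → ℕ) m : ℕ) : ℕ∞) ≤ monomialOrd (fun _ => 1) (Ψ (X m)) :=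
    fun m => by
      rw [Nat.cast_one]
      exact one_le_monomialOrd_one_of_constantCoeff_eq_zero _ (hc.1 m)
  set F : Finset (Fin N) := {i, j, l, e} with hF
  have hFmem : ∀ x ∈ F, x = i ∨ x = j ∨ x = l ∨ x = e := by
    intro x hx
    simpa only [hF, Finset.mem_insert, Finset.mem_singleton] using hx
  have hFcard : F.card = 4 := by
    rw [hF, Finset.card_insert_of_notMem (by simp [hij, hil, hie]),
      Finset.card_insert_of_notMem (by simp [hjl, hje]), Finset.card_pair hle]
  have hentry : ∀ x ∈ F, ∀ y : Fin N,
      ∑ s ∈ S, coeff (Finsupp.single s 1) (Ψ.symm (X x)) * coeff (Finsupp.single y 1) (Ψ (X s)) =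
        if x = y then 1 else 0 := by
    intro x hx y
    rw [Finset.sum_subset (Finset.subset_univ S) (fun s _ hs => by
      rw [hoff s hs x (hFmem x hx), zero_mul])]
    have key := sum_jacobianBlock_symm_mul_jacobianBlock (fun _ : Fin N => (1 : ℕ))
      (fun _ => Nat.one_pos) Ψ hmon (i := x) (l := y) rfl
    rwa [Finset.filter_true_of_mem (fun _ _ => rfl)] at key
  let P : Matrix F S k := Matrix.of fun x s =>
    coeff (Finsupp.single (s : Fin N) 1) (Ψ.symm (X (x : Fin N)))
  let Q : Matrix S F k := Matrix.of fun s y =>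
    coeff (Finsupp.single (y : Fin N) 1) (Ψ (X (s : Fin N)))
  have hPQ : P * Q = 1 := by
    ext x y
    rw [Matrix.mul_apply, Matrix.one_apply]
    have h := hentry x x.2 y
    rw [← Finset.sum_coe_sort S] at h
    simp only [P, Q, Matrix.of_apply]
    rw [h]
    simp only [Subtype.ext_iff]
  have h1 : (1 : Matrix F F k).rank = 4 := by
    rw [Matrix.rank_one, Fintype.card_coe, hFcard]
  have h2 : (P * Q).rank ≤ 3 :=
    (Matrix.rank_mul_le_left P Q).trans ((Matrix.rank_le_card_width P).trans
      (by rw [Fintype.card_coe]; exact hS3))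
  rw [hPQ, h1] at h2
  omega

/-- **Second vertex: `(2, 3, 3, c, …) ∉ W(X_i² + X_l X_j² + X_e^q)` for every `c > q`** (`q ≥ 3`, `2 ≠ 0`
in `k` or `q` odd; `i, j, l, e` distinct, any number of spectators, ALL polynomial coordinate changes).
(derived here) [cite: AbramovichTemkinWlodarczyk2024, Thm. 5.3.1 (2) (p. 1578); Temkin2025, §1.2.2 (1)
(p. 4)] -/
theorem cons₄_not_mem_admissibleInvariants_umbrellaPow (hij : i ≠ j) (hil : i ≠ l) (hie : i ≠ e)
    (hjl : j ≠ l) (hje : j ≠ e) (hle : l ≠ e) (hq : 3 ≤ q) (h2q : (2 : k) ≠ 0 ∨ Odd q) {c : ℚ}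
    (hqc : (q : ℚ) < c) (rest : List ℚ) :
    ((2 : ℚ) :: 3 :: 3 :: c :: rest) ∉ admissibleInvariants (umbrellaPow k i j l e q) := by
  rintro ⟨Ψ, γ, hc, hexps⟩
  have hc3 : (3 : ℚ) < c := lt_of_le_of_lt (by exact_mod_cast hq) hqc
  obtain ⟨a, b₁, b₂, -, -, -, hγa, hγb₁, hγb₂, hE⟩ := weights_of_exps_eq_cons₄ hexps hc3 hc.2.1
  exact not_isCentreFor_umbrellaPow_vertex hij hil hie hjl hje hle hq h2q hγa hγb₁ hγb₂ hqc hE hc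

/-- `q ≠ 0` in `k` forces `2 ≠ 0` in `k` or `q` odd (plumbing). [folklore] -/
private theorem two_ne_zero_or_odd_of_natCast_ne_zero (hqk : (q : k) ≠ 0) : (2 : k) ≠ 0 ∨ Odd q := by
  by_contra h
  push Not at h
  obtain ⟨h2, hodd⟩ := h
  obtain ⟨r, hr⟩ := Nat.not_odd_iff_even.1 hodd
  apply hqk
  rw [hr, Nat.cast_add, ← two_mul, h2, zero_mul]

/-- The germ is non-zero (plumbing). [folklore] -/
private theorem umbrellaPow_ne_zero₄ (hij : i ≠ j) (hil : i ≠ l) (hie : i ≠ e) (hq : q ≠ 0) :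
    umbrellaPow k i j l e q ≠ 0 := by
  intro h0
  have := congrArg (aeval (Pi.single i (1 : k))) h0
  rw [umbrellaPow_eq] at this
  simp [Ne.symm hij, Ne.symm hil, Ne.symm hie, zero_pow hq] at this

/-- **`max W(X_i² + X_l X_j² + X_e^q) = (2, 3, 3, q)`** (`q ≥ 4` invertible in `k`; `i, j, l, e` distinct,
any number of spectator variables, ALL polynomial coordinate changes fixing the origin): the census value of
the normal form `v² + u w² + z^q` is attained by the coordinate centre `(v, w, u, z^{1/q})` with weights
`(1/2, 1/3, 1/3, 1/q)` and is the `TruncLex`-maximum of `W(f)` — first face (`WeightedCentreUmbrellaPowBound`),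
second face (`WeightedCentreSecondFaceSpectators`) and second vertex (this file).  Value type: a typed theorem
in the cell's polynomial model `W(f)` — NOT a resolution theorem. (derived here)
[cite: AbramovichTemkinWlodarczyk2024, Thm. 5.3.1 (2) (p. 1578) (inv = max over admissible centres);
Temkin2025, §1.2.2 (1) (p. 4)] -/
theorem isMaxInv_umbrellaPow (hij : i ≠ j) (hil : i ≠ l) (hie : i ≠ e) (hjl : j ≠ l) (hje : j ≠ e)
    (hle : l ≠ e) (hqk : (q : k) ≠ 0) (hq : 4 ≤ q) :
    IsMaxInv (admissibleInvariants (umbrellaPow k i j l e q)) [(2 : ℚ), 3, 3, (q : ℚ)] := by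
  have h2q := two_ne_zero_or_odd_of_natCast_ne_zero hqk
  refine ⟨umbrellaPow_inv_mem hij hil hie hjl hje hle (by omega), fun b hb hlt => ?_⟩
  have hup : ¬ ATW.TruncLex.lt [(2 : ℚ), 3, 3] b :=
    not_lt_of_mem_admissibleInvariants_umbrellaPow hij hil hie hjl hle hq hb
  have hsf := not_mem_admissibleInvariants_umbrellaAddPowIn_of_ne_zero (k := k) hij hil hie hjl hje hle hqk
    (by omega)
  rw [umbrellaAddPowIn_eq_umbrellaPow] at hsf
  rcases b with _ | ⟨x₁, t₁⟩
  · exact nil_not_mem_admissibleInvariants (umbrellaPow_ne_zero₄ hij hil hie (by omega)) hb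
  rw [ATW.TruncLex.cons_lt_cons] at hup hlt
  push Not at hup
  rcases hlt with h | ⟨rfl, hlt₁⟩
  · exact absurd h (not_lt.2 hup.1)
  have hup₁ := hup.2 rfl
  rcases t₁ with _ | ⟨x₂, t₂⟩
  · exact hsf.2.2 hb
  rw [ATW.TruncLex.cons_lt_cons] at hup₁ hlt₁
  push Not at hup₁
  rcases hlt₁ with h | ⟨rfl, hlt₂⟩
  · exact absurd h (not_lt.2 hup₁.1)
  have hup₂ := hup₁.2 rfl
  rcases t₂ with _ | ⟨x₃, t₃⟩
  · exact hsf.2.1 hb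
  rw [ATW.TruncLex.cons_lt_cons] at hup₂ hlt₂
  push Not at hup₂
  rcases hlt₂ with h | ⟨rfl, hlt₃⟩
  · exact absurd h (not_lt.2 hup₂.1)
  rcases t₃ with _ | ⟨c, rest⟩
  · exact hsf.1 hb
  rw [ATW.TruncLex.cons_lt_cons] at hlt₃
  rcases hlt₃ with hqc | ⟨-, hnil⟩
  · exact cons₄_not_mem_admissibleInvariants_umbrellaPow hij hil hie hjl hje hle (by omega) h2q hqc rest hb
  · exact absurd hnil (ATW.TruncLex.not_nil_lt _)

/-- The four-variable census germ `v² + u w² + z^q` (`WeightedCentreSecondFace.umbrellaAddPow`): its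
`max W` is `(2, 3, 3, q)` for `q ≥ 4` invertible in `k`. (derived here) [cite: Temkin2025, §1.2.2 (1) (p. 4);
AbramovichTemkinWlodarczyk2024, Thm. 5.3.1 (2) (p. 1578)] -/
theorem isMaxInv_umbrellaAddPow {q : ℕ} (hqk : (q : k) ≠ 0) (hq : 4 ≤ q) :
    IsMaxInv (admissibleInvariants (umbrellaAddPow k q)) [(2 : ℚ), 3, 3, (q : ℚ)] := by
  rw [← umbrellaAddPowIn_eq_umbrellaAddPow, umbrellaAddPowIn_eq_umbrellaPow]
  exact isMaxInv_umbrellaPow (by decide) (by decide) (by decide) (by decide) (by decide) (by decide) hqk hq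

end SecondVertex

end Literature.AlgebraicGeometry.Resolution.WeightedBlowup
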